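import Summits.QuantumFields.YangMills.Theorems.BalabanUVNodesN22AtW1Reading12
import Summits.QuantumFields.YangMills.Theorems.BalabanUVNodesN22W1StripLemma3

/-!
# BalabanUVNodes ∕ node N22 = NE9 — THE STRIP INDUCTION AT THE W1 OBJECT, MODULE 7: WHERE IT MEETS THE STAGE-12 HOME AND THE NAMED W1 READING —
# `N22At (u3OfRecord₁₂ θ u k)` for the fixed-carrier W1 bundle and for node00-def-W1's per-run-length reading `ReadingData.u3Objects`, and
# `S_N22 (RRec₁₂ 𝔯)` at the reading of record `RateReading₁₂.ofAssignment (W1.assignment₁₂ 𝔇) ne1`, from STRIP-(1.18) (modules 1–3) + node N18's (O) + the slot's letters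

Cell `pub-ymgap`, HUMAN RULING D-0062 (Track A), R134 ACCELERATION re-seat `pub-ymgap-dag-n22-c` (strategy s1), generation 2, module 7 = trigger (t2) of the seat's
HANDOFF («`𝔯_W1` lands ⇒ check the home slot instantiates by `exact`»), fired by node00-def-W1 g2's `Node00/RateRecordW1Reading.lean` (p465810 ✓ 16f4351f869e) and
dag-n22-e g2's ₁₂ home modules `…N22AtRateRecord12` (p466533 ✓) ∕ `…N22AtRateRecord12Fixed` (p466571 ✓; ROAD 1 at the W1 object).  THEOREMS ONLY; imports dag-n22-e
g2's `…N22AtW1Reading12` (p467930: `s_N22_rRec₁₂_w1_of_oscAnalytic`; through it `…N22AtRateRecord12`'s slot `n22At_u3OfRecord₁₂_of_oscAnalytic`, layer B `RRec₁₂`,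
`u3OfRecord₁₂`, and the named reading `Node00.RateRecordW1Reading`) and module 3 `…N22W1StripLemma3` (STRIP ⇒ the (A) letter, module 2's
`supLetter_functionalOn_of_stripBound`; level T) BY NAME.  `--supports` K3′ (helper).

WHY.  ROAD 3 at the record: `S_N22 (RRec₁₂ 𝔯)` = `N22At` at every level bundle, and the analytic slot closes `N22At (u3OfRecord₁₂ θ u k)` from (P) prefix dependence
(a THEOREM of W1's functional), (O) oscillation fading at the block's NE5 rate `θ₅` (node N18's content — DISPLAYED here) and (A) the young-coupling sup letter
`M·μ^{age−1}·e^{−κd}` on the closed `r`-discs, with the letter equations `ω = θ₅^{1−s}μ^{s}`, `C₉ = (32∕(s²·min(r∕2, γ∕2)))·C₀^{1−s}(2M)^{s}∕(θ₅^{1−s}μ^{s})`.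
Modules 1–3 produce (A) with `M := E₀` from STRIP-(1.18) at every level (itself from the ONE displayed level-T one-step hypothesis + numerals); for the named
reading the letter block IS `LetterInputs.analytic γ`, so both letter equations hold by `rfl` (`ReadingData.u3Objects_ω ∕ _C₉`) once the strip amplitude is read
as the reading's slot amplitude `li.A` and the disc radius as `li.r`.

WHAT.
* §1 `n22At_u3OfRecord₁₂_w1_of_stripBound` — the FIXED-CARRIER W1 bundle `ofFixed (W1.histCarriers (F.P K) M p) (W1.functionalOn S p emb) EB ℓ` at level `k`: STRIP everywhere
  (decay `ℓ.κ`, amplitude `E₀`, radius `r`, window `θ.γ`) + readings in the spaces + (O) at rate `ℓ.θ₅` with constant `C₀` + `0 < C₀ ≤ 2E₀`, `0 < ℓ.θ₅ ≤ μ`, `1 ≤ μ`,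
  `0 < r`, `0 < θ.γ`, `0 < s < 1` + the two letter equations on `ℓ` ⟹ `N22At (u3OfRecord₁₂ θ (ofFixed …) k)` (the letter `E₀·1^{age}` weakened to `E₀·μ^{age}`);
  `n22At_u3OfRecord₁₂_of_w1Level_stripBound` — for ANY `u` whose level-`k` Stage-12 bundle IS that one (one equation `hu`, `rfl` for W1 readings).
* §2 `n22At_u3OfRecord₁₂_w1Reading_of_stripBound` — AT node00-def-W1's NAMED per-run-length reading `D.u3Objects θ.γ` (`D : W1.ReadingData F 𝔸 M`), level `k` (the run of
  `k` steps on `F.P k`): STRIP everywhere for `D.S k` at `(θ.γ, D.li.r, D.li.A, D.li.κ)` + readings of `(D.pairing k).embA` in the spaces + (O) at `D.li.θ₅`, `D.li.C₀` +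
  signs of the inputs (`0 < C₀ ≤ 2A`, `0 < θ₅ ≤ μ`, `1 ≤ μ`, `0 < r`, `0 < s < 1`, `0 < θ.γ`) ⟹ `N22At (u3OfRecord₁₂ θ (D.u3Objects θ.γ) k)` — NO letter hypothesis
  (`u3Objects_ω`, `u3Objects_C₉` are `rfl`), (P) is `prefixDependenceOn_u3Objects_EA`.
* §3 `s_N22_rRec₁₂_w1Assignment_of_stripBound` — AT THE READING OF RECORD `RateReading₁₂.ofAssignment (W1.assignment₁₂ 𝔇) ne1` (θ-form): dag-n22-e g2's ROAD-3
  consumer `YMDAG.N22.s_N22_rRec₁₂_w1_of_oscAnalytic` (p467930) BY NAME with its displayed (A) hypothesis PRODUCED from STRIP (per tuple and run length: a space table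
  with the readings inside + STRIP everywhere for `(𝔇.w1 F θ).S k`) ⟹ `S_N22 (RRec₁₂ _)` — node N22's stub at the Stage-12 home for THE NAMED W1 READING, modulo:
  STRIP-(1.18) (⇐ the level-T one-step hypothesis, module 3), (O) = node N18, readings in the spaces, the inputs' numerals.
* §4 `n22At_u3OfRecord₁₂_w1Reading_of_termwise226Strip` — §2 with STRIP supplied by module 3's `stripBound_termC_of_termwise226Strip` (the level-T hypothesis +
  the socket numerals + S25's clauses + the renewal, `D.li.κ ≤ r₁`).

HONEST FRAMING.  Count-neutral by-name knit; NOT a discharge of N22: (O) is node N18's statement shape (displayed), STRIP ∕ the level-T hypothesis is displayed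
(modules 1–3 HONEST FRAMING verbatim), readings-in-the-spaces is Theorem-1 content, the input signs are the reading's; no inhabitant of `IsDatumOfRecord₁₂C` is
claimed (K0′).  NE9 NOT IN PRINT; one finite four-torus programme at fixed ε — NOT infinite volume, NOT OS on ℝ⁴, NOT a mass gap, NOT Clay.  0 `sorry`, 0 `def`,
standard axioms.

References (TYPES only): [I] = [Balaban1987RG1] §0 p. 256, (0.24)–(0.25) p. 257, (1.18) p. 263, p. 266; [II] = [Balaban1988RG2Cluster] (2.13)–(2.15) pp. 14–15,
(2.26) p. 17, (2.38)–(2.41) pp. 20–21.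
-/

noncomputable section

namespace YMDAG.N22.W1

open Set Metric
open scoped BigOperators
open Literature.MathematicalPhysics.QuantumFieldTheory.Balaban1983to89
open Literature.MathematicalPhysics.QuantumFieldTheory.Balaban1983to89.T4Continuum
open Literature.MathematicalPhysics.QuantumFieldTheory.Balaban1983to89.T4OutputRate
open Literature.MathematicalPhysics.QuantumFieldTheory.Balaban1983to89.TreeLengthTorus (TPt TDom tsys torusTreeLen torusTreeLen_nonneg)
open Literature.MathematicalPhysics.QuantumFieldTheory.Balaban1983to89.B12TreeDecay (K₀ K₀_pos)
open Literature.MathematicalPhysics.QuantumFieldTheory.Balaban1983to89.B13Lemma3TorusData (TBond)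
open Literature.MathematicalPhysics.QuantumFieldTheory.Balaban1983to89.B13Lemma3TorusTerms (terms weight)
open Literature.MathematicalPhysics.QuantumFieldTheory.Balaban1983to89.B13Lemma3TorusSocket (Lemma3Numerics)
open Literature.MathematicalPhysics.QuantumFieldTheory.Balaban1983to89.Node00 (Stage12Params IsDatumOfRecord₁₂C U3Objects₁₁ U3Letters₁₁ MatA)
open Literature.MathematicalPhysics.QuantumFieldTheory.Balaban1983to89.Node00.Sect2 (domSys domCount CPair ofBackgroundC)
open Literature.MathematicalPhysics.QuantumFieldTheory.Balaban1983to89.Node00.W1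
open YMDAG.UVSplit

variable {N : ℕ} [NeZero N]

/-! ## §1 The fixed-carrier W1 bundle at the Stage-12 home from STRIP + (O) -/

section Fixed

variable (F : T4Family) (θ : Stage12Params F N) (K : ℕ) {𝔸 : Type*} {M : ℕ}

open Classical in
/-- **`N22At` AT THE LEVEL-`k` STAGE-12 BUNDLE OF THE FIXED-CARRIER W1 READING, FROM STRIP + (O).**  For W1's tower `S` on `F.P K`, a pairing `p`, run-A backgrounds read through
`emb` INSIDE the space tables (`hsp`), run B's family `EB`, a letter block `ℓ`: STRIP-(1.18) at every level in every coupling on the window `θ.γ` with radius `r`, amplitude `E₀`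
and decay `ℓ.κ` (modules 1∕3's conclusion — displayed here) + (O) oscillation fading at rate `ℓ.θ₅` with constant `C₀` (node N18's shape — displayed) + the slot's signs and
the two letter equations on `ℓ` (`ω = θ₅^{1−s}μ^{s}`, `C₉ = …(2E₀)^{s}…`) ⟹ `N22At (u3OfRecord₁₂ θ (ofFixed (histCarriers (F.P K) M p) (functionalOn S p emb) EB ℓ) k)`:
(P) is W1's `functionalOn_prefixDependenceOn`, (A) is module 2's `supLetter_functionalOn_of_stripBound` (`E₀·1^{age} ≤ E₀·μ^{age}` for `μ ≥ 1`), then dag-n22-e's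
`n22At_u3OfRecord₁₂_of_oscAnalytic`. [folklore] -/
theorem n22At_u3OfRecord₁₂_w1_of_stripBound (S : ClusterTower (F.P K) 𝔸 M) (p : RunPairing) (emb : p.BgA → CPair (F.P K) 𝔸)
    (EB : ℝ → Functional (histCarriers (F.P K) M p) (histCarriers (F.P K) M p).BgB) (ℓ : U3Letters₁₁) (k : ℕ)
    (sp : (j : ℕ) → (domSys (F.P K) M j).Dom → Set (CPair (F.P K) 𝔸)) (hsp : ∀ (j : ℕ) (U : p.BgA) (Y : (domSys (F.P K) M j).Dom), emb U ∈ sp j Y)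
    {r E₀ C₀ μ s : ℝ}
    (hall : ∀ (j : ℕ) (g : ℕ → ℝ), g ∈ Window θ.γ → ∀ (i : ℕ) (Y : (domSys (F.P K) M j).Dom) (ψ : CPair (F.P K) 𝔸), ψ ∈ sp j Y →
      ∃ (Ec : ℂ → ℂ) (O : Set ℂ), IsOpen O ∧ (∀ t ∈ Ioc (0 : ℝ) θ.γ, closedBall (t : ℂ) r ⊆ O) ∧ DifferentiableOn ℂ Ec O ∧
        (∀ z ∈ O, ‖Ec z‖ ≤ E₀ * Real.exp (-(ℓ.κ * torusTreeLen Y.1))) ∧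
        (∀ t ∈ Ioc (0 : ℝ) θ.γ, Ec t = termC S j Y (Function.update g i t) ψ))
    (hO : ∀ g ∈ Window θ.γ, ∀ g' ∈ Window θ.γ, ∀ (U : p.BgA) (X : (histCarriers (F.P K) M p).Dom) (a : ℕ), a ≤ (histCarriers (F.P K) M p).scale X →
      (∀ n, a ≤ n → g n = g' n) → |functionalOn S p emb g U X - functionalOn S p emb g' U X| ≤
        C₀ * ℓ.θ₅ ^ ((histCarriers (F.P K) M p).scale X - a) * Real.exp (-(ℓ.κ * (histCarriers (F.P K) M p).d X)))
    (hC₀ : 0 < C₀) (hθ : 0 < ℓ.θ₅) (hE₀ : 0 < E₀) (hμ1 : 1 ≤ μ) (hθμ : ℓ.θ₅ ≤ μ) (hCM : C₀ ≤ 2 * E₀) (hr : 0 < r) (hγ : 0 < θ.γ)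
    (hs0 : 0 < s) (hs1 : s < 1) (hω : ℓ.ω = ℓ.θ₅ ^ (1 - s) * μ ^ s)
    (hC₉ : ℓ.C₉ = 32 / (s ^ 2 * min (r / 2) (θ.γ / 2)) * (C₀ ^ (1 - s) * (2 * E₀) ^ s) / (ℓ.θ₅ ^ (1 - s) * μ ^ s)) :
    N22At (u3OfRecord₁₂ θ (U3Objects₁₁.ofFixed (histCarriers (F.P K) M p) (functionalOn S p emb) EB ℓ) k) := by
  have hAone := supLetter_functionalOn_of_stripBound S p emb sp hsp hall
  refine n22At_u3OfRecord₁₂_of_oscAnalytic θ _ k (functionalOn_prefixDependenceOn S p emb (Window θ.γ)) hO (fun g hg U X i hi => ?_)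
    hC₀ hθ hE₀ hθμ hCM hr hγ hs0 hs1 hω hC₉
  obtain ⟨Fz, Dset, hF, hB, hdisc, hrep⟩ := hAone g hg U X i hi
  refine ⟨Fz, Dset, hF, fun z hz => (hB z hz).trans ?_, hdisc, hrep⟩
  rw [one_pow, mul_one]
  exact mul_le_mul_of_nonneg_right (le_mul_of_one_le_right hE₀.le (one_le_pow₀ hμ1)) (Real.exp_nonneg _)

/-- **… AT THE LEVEL-`k` BUNDLE OF ANY `u : U3Objects₁₁` WHOSE STAGE-12 BUNDLE IS THE FIXED-CARRIER W1 ONE** (one equation `hu`; `rfl` for node00-def-W1's reading —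
dag-n22-e's pattern `n22At_u3OfRecord₁₂_of_w1Level`). [folklore] -/
theorem n22At_u3OfRecord₁₂_of_w1Level_stripBound (u : U3Objects₁₁) (k : ℕ) (S : ClusterTower (F.P K) 𝔸 M) (p : RunPairing)
    (emb : p.BgA → CPair (F.P K) 𝔸) (EB : ℝ → Functional (histCarriers (F.P K) M p) (histCarriers (F.P K) M p).BgB) (ℓ : U3Letters₁₁)
    (hu : u3OfRecord₁₂ θ u k = u3OfRecord₁₂ θ (U3Objects₁₁.ofFixed (histCarriers (F.P K) M p) (functionalOn S p emb) EB ℓ) k)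
    (sp : (j : ℕ) → (domSys (F.P K) M j).Dom → Set (CPair (F.P K) 𝔸)) (hsp : ∀ (j : ℕ) (U : p.BgA) (Y : (domSys (F.P K) M j).Dom), emb U ∈ sp j Y)
    {r E₀ C₀ μ s : ℝ}
    (hall : ∀ (j : ℕ) (g : ℕ → ℝ), g ∈ Window θ.γ → ∀ (i : ℕ) (Y : (domSys (F.P K) M j).Dom) (ψ : CPair (F.P K) 𝔸), ψ ∈ sp j Y →
      ∃ (Ec : ℂ → ℂ) (O : Set ℂ), IsOpen O ∧ (∀ t ∈ Ioc (0 : ℝ) θ.γ, closedBall (t : ℂ) r ⊆ O) ∧ DifferentiableOn ℂ Ec O ∧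
        (∀ z ∈ O, ‖Ec z‖ ≤ E₀ * Real.exp (-(ℓ.κ * torusTreeLen Y.1))) ∧
        (∀ t ∈ Ioc (0 : ℝ) θ.γ, Ec t = termC S j Y (Function.update g i t) ψ))
    (hO : ∀ g ∈ Window θ.γ, ∀ g' ∈ Window θ.γ, ∀ (U : p.BgA) (X : (histCarriers (F.P K) M p).Dom) (a : ℕ), a ≤ (histCarriers (F.P K) M p).scale X →
      (∀ n, a ≤ n → g n = g' n) → |functionalOn S p emb g U X - functionalOn S p emb g' U X| ≤
        C₀ * ℓ.θ₅ ^ ((histCarriers (F.P K) M p).scale X - a) * Real.exp (-(ℓ.κ * (histCarriers (F.P K) M p).d X)))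
    (hC₀ : 0 < C₀) (hθ : 0 < ℓ.θ₅) (hE₀ : 0 < E₀) (hμ1 : 1 ≤ μ) (hθμ : ℓ.θ₅ ≤ μ) (hCM : C₀ ≤ 2 * E₀) (hr : 0 < r) (hγ : 0 < θ.γ)
    (hs0 : 0 < s) (hs1 : s < 1) (hω : ℓ.ω = ℓ.θ₅ ^ (1 - s) * μ ^ s)
    (hC₉ : ℓ.C₉ = 32 / (s ^ 2 * min (r / 2) (θ.γ / 2)) * (C₀ ^ (1 - s) * (2 * E₀) ^ s) / (ℓ.θ₅ ^ (1 - s) * μ ^ s)) :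
    N22At (u3OfRecord₁₂ θ u k) := by
  rw [hu]
  exact n22At_u3OfRecord₁₂_w1_of_stripBound F θ K S p emb EB ℓ k sp hsp hall hO hC₀ hθ hE₀ hμ1 hθμ hCM hr hγ hs0 hs1 hω hC₉

end Fixed

/-! ## §2 At node00-def-W1's NAMED per-run-length reading `ReadingData.u3Objects` — no letter hypothesis -/

section Reading

variable {F : T4Family} (θ : Stage12Params F N) {𝔸 : Type*} {M : ℕ} (D : ReadingData F 𝔸 M) (k : ℕ)

open Classical in
/-- **`N22At` AT THE LEVEL-`k` BUNDLE OF THE NAMED W1 READING, FROM STRIP + (O).**  For node00-def-W1's reading data `D` (towers `D.S k` on `F.P k`, level pairings, letter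
inputs `D.li`) at window radius `θ.γ`, level `k`: STRIP-(1.18) at every level in every coupling for `D.S k` with radius `D.li.r`, amplitude `D.li.A` (the reading's slot
amplitude) and decay `D.li.κ` + readings `(D.pairing k).embA U` inside the space tables + (O) at rate `D.li.θ₅` with constant `D.li.C₀` + the input signs
(`0 < C₀ ≤ 2A`, `0 < θ₅ ≤ μ`, `1 ≤ μ`, `0 < r`, `0 < s < 1`, `0 < θ.γ`) ⟹ `N22At (u3OfRecord₁₂ θ (D.u3Objects θ.γ) k)`.  The letter equations are the reading's
`u3Objects_ω` ∕ `u3Objects_C₉` (`rfl`); (P) is `prefixDependenceOn_u3Objects_EA`. [folklore] -/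
theorem n22At_u3OfRecord₁₂_w1Reading_of_stripBound
    (sp : (j : ℕ) → (domSys (F.P k) M j).Dom → Set (CPair (F.P k) 𝔸))
    (hsp : ∀ (j : ℕ) (U : (D.pairing k).BgA) (Y : (domSys (F.P k) M j).Dom), (D.pairing k).embA U ∈ sp j Y)
    (hall : ∀ (j : ℕ) (g : ℕ → ℝ), g ∈ Window θ.γ → ∀ (i : ℕ) (Y : (domSys (F.P k) M j).Dom) (ψ : CPair (F.P k) 𝔸), ψ ∈ sp j Y →
      ∃ (Ec : ℂ → ℂ) (O : Set ℂ), IsOpen O ∧ (∀ t ∈ Ioc (0 : ℝ) θ.γ, closedBall (t : ℂ) D.li.r ⊆ O) ∧ DifferentiableOn ℂ Ec O ∧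
        (∀ z ∈ O, ‖Ec z‖ ≤ D.li.A * Real.exp (-(D.li.κ * torusTreeLen Y.1))) ∧
        (∀ t ∈ Ioc (0 : ℝ) θ.γ, Ec t = termC (D.S k) j Y (Function.update g i t) ψ))
    (hO : ∀ g ∈ Window θ.γ, ∀ g' ∈ Window θ.γ, ∀ (U : (D.pairing k).BgA) (X : (D.pairing k).carriers.Dom) (a : ℕ), a ≤ (D.pairing k).carriers.scale X →
      (∀ n, a ≤ n → g n = g' n) → |(D.pairing k).EA (D.S k) g U X - (D.pairing k).EA (D.S k) g' U X| ≤
        D.li.C₀ * D.li.θ₅ ^ ((D.pairing k).carriers.scale X - a) * Real.exp (-(D.li.κ * (D.pairing k).carriers.d X)))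
    (hC₀ : 0 < D.li.C₀) (hθ : 0 < D.li.θ₅) (hA : 0 < D.li.A) (hμ1 : 1 ≤ D.li.μ) (hθμ : D.li.θ₅ ≤ D.li.μ) (hCM : D.li.C₀ ≤ 2 * D.li.A)
    (hr : 0 < D.li.r) (hγ : 0 < θ.γ) (hs0 : 0 < D.li.s) (hs1 : D.li.s < 1) :
    N22At (u3OfRecord₁₂ θ (D.u3Objects θ.γ) k) := by
  have hAone := supLetter_functionalOn_of_stripBound (D.S k) (D.pairing k).toRunPairing (D.pairing k).embA sp hsp hall
  refine n22At_u3OfRecord₁₂_of_oscAnalytic θ (D.u3Objects θ.γ) k (D.prefixDependenceOn_u3Objects_EA θ.γ k (Window θ.γ)) hO (fun g hg U X i hi => ?_)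
    hC₀ hθ hA hθμ hCM hr hγ hs0 hs1 (D.u3Objects_ω θ.γ) (D.u3Objects_C₉ θ.γ)
  obtain ⟨Fz, Dset, hF, hB, hdisc, hrep⟩ := hAone g hg U X i hi
  refine ⟨Fz, Dset, hF, fun z hz => (hB z hz).trans ?_, hdisc, hrep⟩
  rw [one_pow, mul_one]
  exact mul_le_mul_of_nonneg_right (le_mul_of_one_le_right hA.le (one_le_pow₀ hμ1)) (Real.exp_nonneg _)

end Reading

/-! ## §3 At the reading OF RECORD `RateReading₁₂.ofAssignment (W1.assignment₁₂ 𝔇) ne1`: dag-n22-e's consumer shape with (A) PRODUCED from STRIP -/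

section Record

variable (𝔇 : AssignmentInputs₁₂ N) (ne1 : (F : T4Family) → Stage12Params F N → (ℕ → ℝ) → List (ULoop F) → NE1pCarriers)

open Classical in
/-- **NODE N22's STUB AT THE STAGE-12 HOME FOR THE NAMED W1 READING OF RECORD: dag-n22-e's ROAD-3 consumer `s_N22_rRec₁₂_w1_of_oscAnalytic` (p467930) WITH ITS (A)
HYPOTHESIS PRODUCED FROM STRIP.**  Hypotheses (θ-form, per admissible Stage-12 tuple with provisos): the inputs' numerals (dag-n22-e's eight + `1 ≤ li.μ`), node N18's (O) on
the reading's level objects (verbatim dag-n22-e's `hO` — displayed), and, per run length `k`, a space table on the `k`-th torus with the readings `embA U` inside and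
STRIP-(1.18) at every level in every coupling for the tower `(𝔇.w1 F θ).S k` with radius `li.r`, amplitude `li.A`, decay `li.κ` (modules 1∕3's conclusion — displayed here;
§4 ∕ module 3 produce it from the level-T one-step hypothesis).  Conclusion: `S_N22 (RRec₁₂ (RateReading₁₂.ofAssignment (W1.assignment₁₂ 𝔇) ne1))`.  The (A) letter
handed to dag-n22-e's theorem is module 2's `supLetter_functionalOn_of_stripBound` (`li.A·1^{age} ≤ li.A·li.μ^{age}`); the reading's objects ARE W1's by `rfl`.
[folklore] -/
theorem s_N22_rRec₁₂_w1Assignment_of_stripBound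
    (hnum : ∀ (F : T4Family) (θ : Stage12Params F N), θ.Provisos₁₂ F N → θ.Admissible F N →
      0 < (𝔇.w1 F θ).li.C₀ ∧ 0 < (𝔇.w1 F θ).li.θ₅ ∧ 0 < (𝔇.w1 F θ).li.A ∧ (𝔇.w1 F θ).li.θ₅ ≤ (𝔇.w1 F θ).li.μ ∧
        (𝔇.w1 F θ).li.C₀ ≤ 2 * (𝔇.w1 F θ).li.A ∧ 0 < (𝔇.w1 F θ).li.r ∧ 0 < (𝔇.w1 F θ).li.s ∧ (𝔇.w1 F θ).li.s < 1 ∧ 1 ≤ (𝔇.w1 F θ).li.μ)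
    (hO : ∀ (F : T4Family) (θ : Stage12Params F N), θ.Provisos₁₂ F N → θ.Admissible F N → ∀ (k : ℕ),
      ∀ g ∈ Window θ.γ, ∀ g' ∈ Window θ.γ, ∀ (U : (((𝔇.w1 F θ).u3Objects θ.γ).levelCarriers k).BgA)
        (X : (((𝔇.w1 F θ).u3Objects θ.γ).levelCarriers k).Dom) (a : ℕ), a ≤ (((𝔇.w1 F θ).u3Objects θ.γ).levelCarriers k).scale X →
        (∀ n, a ≤ n → g n = g' n) →
          |((𝔇.w1 F θ).u3Objects θ.γ).EA k g U X - ((𝔇.w1 F θ).u3Objects θ.γ).EA k g' U X| ≤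
            (𝔇.w1 F θ).li.C₀ * ((𝔇.w1 F θ).u3Objects θ.γ).θ₅ ^ ((((𝔇.w1 F θ).u3Objects θ.γ).levelCarriers k).scale X - a) *
              Real.exp (-(((𝔇.w1 F θ).u3Objects θ.γ).κ * (((𝔇.w1 F θ).u3Objects θ.γ).levelCarriers k).d X)))
    (hstrip : ∀ (F : T4Family) (θ : Stage12Params F N), θ.Provisos₁₂ F N → θ.Admissible F N → ∀ (k : ℕ),
      ∃ sp : (j : ℕ) → (domSys (F.P k) θ.τ9.M j).Dom → Set (CPair (F.P k) (MatA N)),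
        (∀ (j : ℕ) (U : ((𝔇.w1 F θ).pairing k).BgA) (Y : (domSys (F.P k) θ.τ9.M j).Dom), ((𝔇.w1 F θ).pairing k).embA U ∈ sp j Y) ∧
        (∀ (j : ℕ) (g : ℕ → ℝ), g ∈ Window θ.γ → ∀ (i : ℕ) (Y : (domSys (F.P k) θ.τ9.M j).Dom) (ψ : CPair (F.P k) (MatA N)), ψ ∈ sp j Y →
          ∃ (Ec : ℂ → ℂ) (O : Set ℂ), IsOpen O ∧ (∀ t ∈ Ioc (0 : ℝ) θ.γ, closedBall (t : ℂ) (𝔇.w1 F θ).li.r ⊆ O) ∧ DifferentiableOn ℂ Ec O ∧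
            (∀ z ∈ O, ‖Ec z‖ ≤ (𝔇.w1 F θ).li.A * Real.exp (-((𝔇.w1 F θ).li.κ * torusTreeLen Y.1))) ∧
            (∀ t ∈ Ioc (0 : ℝ) θ.γ, Ec t = termC ((𝔇.w1 F θ).S k) j Y (Function.update g i t) ψ))) :
    S_N22 (RRec₁₂ (RateReading₁₂.ofAssignment (assignment₁₂ 𝔇) ne1)) := by
  refine YMDAG.N22.s_N22_rRec₁₂_w1_of_oscAnalytic 𝔇 ne1 (fun F θ hP hθ => ?_) hO (fun F θ hP hθ k g hg U X i hi => ?_)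
  · obtain ⟨h1, h2, h3, h4, h5, h6, h7, h8, -⟩ := hnum F θ hP hθ
    exact ⟨h1, h2, h3, h4, h5, h6, h7, h8⟩
  · obtain ⟨-, -, hA, -, -, -, -, -, hμ1⟩ := hnum F θ hP hθ
    obtain ⟨sp, hsp, hall⟩ := hstrip F θ hP hθ k
    obtain ⟨Fz, Dset, hF, hB, hdisc, hrep⟩ :=
      supLetter_functionalOn_of_stripBound ((𝔇.w1 F θ).S k) ((𝔇.w1 F θ).pairing k).toRunPairing ((𝔇.w1 F θ).pairing k).embA sp hsp hall
        g hg U X i hi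
    refine ⟨Fz, Dset, hF, fun z hz => (hB z hz).trans ?_, hdisc, hrep⟩
    rw [one_pow, mul_one]
    exact mul_le_mul_of_nonneg_right (le_mul_of_one_le_right hA.le (one_le_pow₀ hμ1)) (Real.exp_nonneg _)

end Record

/-! ## §4 The named reading, end to end from the level-T strip hypothesis (module 3) -/

section LevelT

variable {F : T4Family} (θ : Stage12Params F N) {𝔸 : Type*} {M : ℕ} (D : ReadingData F 𝔸 M) (k : ℕ)

open Classical in
/-- **`N22At` AT THE NAMED W1 READING FROM THE LEVEL-T ONE-STEP HYPOTHESIS + (O)**: §2 with STRIP-(1.18) supplied by module 3's `stripBound_termC_of_termwise226Strip` for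
the tower `D.S k` on `F.P k` — the displayed level-T hypothesis ([II] (2.15)–(2.26) per term read on the strip), the socket numerals `Lemma3Numerics c M (½L) …`, `8 ≤ c.L`,
S25's two clauses at `A := C₃ε₁`, `R := (1−8δ)½Lκ`, `D.li.κ ≤ r₁`, and the renewal `e·9·64·K₀(64,8)²·C₃ε₁ ≤ D.li.A`. [folklore] -/
theorem n22At_u3OfRecord₁₂_w1Reading_of_termwise226Strip [NeZero M]
    (sp : (j : ℕ) → (domSys (F.P k) M j).Dom → Set (CPair (F.P k) 𝔸))
    (hsp : ∀ (j : ℕ) (U : (D.pairing k).BgA) (Y : (domSys (F.P k) M j).Dom), (D.pairing k).embA U ∈ sp j Y) (c : B13.Consts) {L : ℕ} [NeZero L]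
    (hL : 8 ≤ c.L) (hLc : c.L = L) {a a₂ a₂' a₅ Aabs : ℝ} (hN : Lemma3Numerics c M ((c.L : ℝ) / 2) a a₂ a₂' a₅ Aabs)
    {r₁ : ℝ} (hA0 : 0 ≤ c.C3act * c.ε₁) (hr₁ : 0 ≤ r₁) (hκ : D.li.κ ≤ r₁)
    (hrate : r₁ + 2 * (64 * Real.log 162) + 2 ≤ (1 - 8 * c.δ) * ((c.L : ℝ) / 2) * c.κ)
    (hsmall : c.C3act * c.ε₁ * Real.exp (5 * r₁ + 1) * K₀ 64 8 * 9 * 64 ≤ 1)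
    (hrenew : Real.exp 1 * 9 * 64 * K₀ 64 8 ^ 2 * (c.C3act * c.ε₁) ≤ D.li.A)
    (h226T : ∀ (k' : ℕ) (g : ℕ → ℝ), g ∈ Window θ.γ → ∀ (i : ℕ), i < k' + 1 → ∀ (X : (domSys (F.P k) M (k' + 1)).Dom) (φ : CPair (F.P k) 𝔸),
      φ ∈ sp (k' + 1) X →
      (∀ (j : ℕ), j < k' + 1 → ∀ (Y : (domSys (F.P k) M j).Dom) (ψ : CPair (F.P k) 𝔸), ψ ∈ sp j Y →
        ∃ (Ec : ℂ → ℂ) (O : Set ℂ), IsOpen O ∧ (∀ t ∈ Ioc (0 : ℝ) θ.γ, closedBall (t : ℂ) D.li.r ⊆ O) ∧ DifferentiableOn ℂ Ec O ∧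
          (∀ z ∈ O, ‖Ec z‖ ≤ D.li.A * Real.exp (-(D.li.κ * torusTreeLen Y.1))) ∧
          (∀ t ∈ Ioc (0 : ℝ) θ.γ, Ec t = termC (D.S k) j Y (Function.update g i t) ψ)) →
      ∃ (Hc : ℂ → TDom 4 (domCount (F.P k) M (k' + 1)) → ℂ)
        (Tt : (Z : TDom 4 (domCount (F.P k) M (k' + 1))) →
          Finset (TDom 4 (L * domCount (F.P k) M (k' + 1))) × Finset (TBond 4 M (L * domCount (F.P k) M (k' + 1))) → ℂ → ℂ)
        (O : Set ℂ), IsOpen O ∧ (∀ t ∈ Ioc (0 : ℝ) θ.γ, closedBall (t : ℂ) D.li.r ⊆ O) ∧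
        (∀ Z : (domSys (F.P k) M (k' + 1)).Dom, Z.1 ⊆ X.1 → DifferentiableOn ℂ (fun z => Hc z Z) O) ∧
        (∀ z ∈ O, ∀ Z : TDom 4 (domCount (F.P k) M (k' + 1)), Z.1 ⊆ X.1 → ‖Hc z Z‖ ≤ ∑ t ∈ terms L M Z, ‖Tt Z t z‖) ∧
        (∀ z ∈ O, ∀ Z : TDom 4 (domCount (F.P k) M (k' + 1)), Z.1 ⊆ X.1 → ∀ t ∈ terms L M Z,
          ‖Tt Z t z‖ ≤ weight L M c Z a t * Real.exp (a₅ * ((Z.1).card : ℝ))) ∧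
        (∀ t ∈ Ioc (0 : ℝ) θ.γ, Hc t = ((D.S k) k').H (restrictPrefix k' (Function.update g i t)) φ))
    (hO : ∀ g ∈ Window θ.γ, ∀ g' ∈ Window θ.γ, ∀ (U : (D.pairing k).BgA) (X : (D.pairing k).carriers.Dom) (a : ℕ), a ≤ (D.pairing k).carriers.scale X →
      (∀ n, a ≤ n → g n = g' n) → |(D.pairing k).EA (D.S k) g U X - (D.pairing k).EA (D.S k) g' U X| ≤
        D.li.C₀ * D.li.θ₅ ^ ((D.pairing k).carriers.scale X - a) * Real.exp (-(D.li.κ * (D.pairing k).carriers.d X)))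
    (hC₀ : 0 < D.li.C₀) (hθ : 0 < D.li.θ₅) (hA : 0 < D.li.A) (hμ1 : 1 ≤ D.li.μ) (hθμ : D.li.θ₅ ≤ D.li.μ) (hCM : D.li.C₀ ≤ 2 * D.li.A)
    (hr : 0 < D.li.r) (hγ : 0 < θ.γ) (hs0 : 0 < D.li.s) (hs1 : D.li.s < 1) :
    N22At (u3OfRecord₁₂ θ (D.u3Objects θ.γ) k) :=
  n22At_u3OfRecord₁₂_w1Reading_of_stripBound θ D k sp hsp
    (stripBound_termC_of_termwise226Strip F k (D.S k) sp c hL hLc hN hr.le hA0 hr₁ hκ hrate hsmall hrenew h226T)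
    hO hC₀ hθ hA hμ1 hθμ hCM hr hγ hs0 hs1

end LevelT

end YMDAG.N22.W1

end
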